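import Mathlib
import Literature.Computability.AlgebraicComplexity.NewtonPolygonTauTransfer
import Literature.Algebra.Polynomial.NewtonPolytope
import HarnessLib

/-!
# KPTT 2015, §2 — the "easy" Newton-polygon bounds for PRODUCTS: the vertex count of a planar
# Minkowski sum, `Newt(g₁ ⋯ g_m)` has at most `Σ_j t_j` vertices, and `k m t` without cancellations

Topic `Literature/Computability/AlgebraicComplexity`, companion of `NewtonPolygonTau.lean`
(`newtonVertexCount`, Conjecture 1, Thms 1/5/6), `NewtonPolygonTauProofs.lean`,
`NewtonPolygonTauBounds.lean` (EPRS), `NewtonPolygonTauTransfer.lean` (Thm 1). Cell `val-lit`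
(unit val-lit-t17 g6, 2026-08-27; rung V5 of the Valiant ladder = KPTT/τ routes NewtonFrames,
DissociatedFixedK, NewtonUnitEquations). ONE definition with a body (`IsStrictTop`, the strict
maximiser of a linear weight on a finite planar set), everything else THEOREMS; no named fact,
no `sorry`; net debt 0.

## Source, quoted verbatim

P. Koiran, N. Portier, S. Tavenas, S. Thomassé, *A τ-conjecture for Newton polygons*, Found.
Comput. Math. 15 (2015) 185–197 = arXiv:1308.2286 [KoiranPortierTavenasThomasse2015], §2 (held
text `paper:arxiv-1308.2286`, p0004.txt):
* L14: «Note that `Newt(f)` has at most `t` edges if `f` has `t` monomials.»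
* L15–L19: «It is well known [Ostro75] that the Newton polygon of a product of polynomials is the
  Minkowski sum of their Newton polygons … As a result, if `f` has `s` monomials and `g` has `t`
  monomials then `Newt(fg)` has at most `s + t` edges.»
* L20–L22: «More generally, for a product `f = g_1 g_2 ⋯ g_m`, `Newt(f)` has at most `Σ_{i=1}^m t_i`
  edges where `t_i` is the number of monomials of `g_i`; but `f` can of course have up to
  `Π_{i=1}^m t_i` monomials.»
* L69–L73: «If there are no cancellations (for instance, if the `f_ij` only have positive
  coefficients) then we indeed have a polynomial upper bound. In this case, `Newt(f)` is the convex
  hull of the union of the Newton polygons of the `k` products. Each of these `k` Newton polygons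
  has at most `mt` vertices, so `Newt(f)` has at most `kmt` vertices and as many edges.»
These sentences carry no theorem number in print; they are tagged `[cite: …, §2 (p.4)]` below.
The convex-geometry core behind them — a Minkowski sum of two convex polygons with `p` and `q`
vertices has at most `p + q` vertices (planar case of Gritzmann–Sturmfels 1993
[GritzmannSturmfels1993], cite-only; standard in computational geometry) — was absent from Mathlib
and from the tree (the tree had only the factor-two form `hex_newtonVertexCount_mul_le` on the
Summits side) and is PROVED here from first principles.

## What is formalised (namespace `Literature.Computability.AlgebraicComplexity`)

Planar geometry of finite point sets `F : Finset (Fin 2 → ℝ)` (sub-namespace `KPTT.PlanarMinkowski`):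
* `IsStrictTop w F x` — `x` is the strict maximiser of `⟨w, ·⟩` on `F` (definition with body);
  API: uniqueness, positive rescaling, `IsStrictTop.add` / `IsStrictTop.exists_eq_add` (tops of
  `A + B` are exactly sums of tops), `IsStrictTop.finset_sum` / `fintype_sum` (finitely many summands), `IsStrictTop.mem_extremePoints` (tops are hull vertices, via
  the tree's `KPTT.mem_extremePoints_convexHull_of_linear`), `eq_of_add_eq_of_mem_extremePoints`
  (a hull vertex of `A + B` decomposes uniquely), interval fibres along the affine charts of
  weights `t ↦ (σ, t)` (`IsStrictTop.of_between`), openness (`exists_perturb_dir/_chart`).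
* Exposure and charts: `exists_isStrictTop_of_mem_extremePoints` (Hahn–Banach: every hull vertex
  is a strict top), `mem_extremePoints_iff_charts` (… along one of the two half-charts `(1, t)`,
  `(-1, t)`), `exists_isStrictTop_chart` (lexicographic tops exist), `exists_chart_injOn`
  (GENERIC charts: the exposing weight can be taken injective on any prescribed finite family of
  finite sets — the input an exchange argument on sub-sumsets needs).
* Counting: `card_image_pair_add_one_le` (two interval-fibred maps on a finite linear order realise
  at most `#values + #values − 1` pairs), `card_chartTops_add_le` (chart tops of `A + B`),
  `IsStrictTop.top_or_bot_of_charts` (a strict top in BOTH half-charts is the unique top or bottom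
  point) and the assembly
  **`ncard_extremePoints_add_le`: `#vert conv(A + B) ≤ #vert conv(A) + #vert conv(B)`**
  (finite nonempty `A, B ⊂ ℝ²`), with `ncard_extremePoints_sum_le` (finitely many summands),
  `…_sum_le_sum_card` (`≤ Σ #A_j`), `ncard_extremePoints_biUnion_le` (hull of a union), and the
  lattice forms `ncard_extremePoints_sumset_le_sum_card` / `ncard_extremePoints_sumset_le_sq` for
  sumsets `{Σ_j a_j : a_j ∈ A_j}` of exponent sets `A_j ⊂ ℕ²` in the verbatim currency of the
  Summits support item `SumsetVertexBound` (exponent `c = 2`).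
* Newton polygons (`newtonVertexCount` of `NewtonPolygonTau.lean`, any commutative semiring `k`
  without zero divisors): `extremePoints_support_add_subset_support_mul` (vertices of
  `supp p + supp q` are monomials of `pq` — Ostrowski's non-cancellation),
  **`newtonVertexCount_mul_le : V(pq) ≤ V(p) + V(q)`**, `newtonVertexCount_prod_le`
  (`V(Π_j g_j) ≤ Σ_j V(g_j)`), `…_prod_le_sum_card` (`≤ Σ_j t_j`, KPTT's form), `…_prod_le_mul`
  (`≤ m t`), `newtonVertexCount_sum_le_of_support_eq` and `…_sum_prod_le_of_support_eq` (`≤ k m t`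
  when the support of the sum is the union of the supports = "no cancellations").

Proof route for the vertex count (not KPTT's, who cite it as well known; ours is chart-based and
elementary): every hull vertex is a strict top along one of the two half-charts `w = (±1, t)`;
along one half-chart the pair `(top_w A, top_w B)` has interval fibres in `t`, so at most
`#tops(A) + #tops(B) − 1` pairs occur; the two half-charts double-count exactly the unique top and
bottom points, and "unique top of `A + B` exists iff both summands have one" closes the books:
`V(A+B) ≤ V(A) + V(B)` with no loss. Typed-vs-printed: KPTT state EDGE counts and monomial counts
`s + t`, `Σ t_i`; we prove the sharper VERTEX forms (`#vert ≤ Σ #vert ≤ Σ t_i`; for a polygon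
edges = vertices) over any coefficient semiring without zero divisors (KPTT: a field; §4 "fields
of arbitrary characteristic"); the `kmt` sentence is typed with its hypothesis "no cancellations"
rendered as `supp(Σ_i P_i) = ⋃_i supp(P_i)`.

Consumers named at filing (cell bus 2026-08-27): the Summits support item `SumsetVertexBound`
(`Cruxes/DissociatedFixedK/SketchIdeator3.lean`, there only derived from the open crux
`NewtonFrames.ShallowChains`), the `C = ∅` half and the corner count of crux stmt-7365
`ShallowChains` (via `exists_chart_injOn`), KPTT's `kmt` sentence, and the factor in
`hex_newtonVertexCount_mul_le`. HONEST FRAMING: textbook convex geometry — KPTT's "easy to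
control" case of products; nothing here bears on Conjecture 1, on the τ-conjecture, or on
`VP ≠ VNP`.

## References

* [KoiranPortierTavenasThomasse2015] P. Koiran, N. Portier, S. Tavenas, S. Thomassé, Found. Comput.
  Math. 15 (2015) 185–197, arXiv:1308.2286, §2 (p. 4, lines quoted above).
* [GritzmannSturmfels1993] P. Gritzmann, B. Sturmfels, *Minkowski addition of polytopes:
  computational complexity and applications to Gröbner bases*, SIAM J. Discrete Math. 6 (1993)
  246–269 (vertex counts of Minkowski sums; planar case) — cite-only.
* A. M. Ostrowski, *On multiplication and factorization of polynomials, I. Lexicographic orderings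
  and extreme aggregates of terms*, Aequationes Math. 13 (1975) 201–228 (KPTT's [Ostro75]); in the
  tree as `Literature.Algebra.Polynomial.NewtonPolytope.newtonPolytope_mul`.
-/

noncomputable section

open Matrix Finset
open scoped Pointwise

namespace Literature.Computability.AlgebraicComplexity

namespace KPTT

namespace PlanarMinkowski

/-- `x` is the STRICT TOP of the finite planar point set `F` for the weight vector `w`: `x ∈ F` and
`⟨w, y⟩ < ⟨w, x⟩` for every other point `y` of `F`, i.e. the support set of `F` with exterior normal `w`
is the single point `x` (Schneider's `F(K, u) = {x}`; `x` is the vertex of `conv F` exposed by `w`).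
[cite: Schneider1993, §1.7 (support set F(K,u); Cor 1.7.3: a one-point support set; held text p0043:L7, p0045:L29)] -/
def IsStrictTop (w : Fin 2 → ℝ) (F : Finset (Fin 2 → ℝ)) (x : Fin 2 → ℝ) : Prop :=
  x ∈ F ∧ ∀ y ∈ F, y ≠ x → w ⬝ᵥ y < w ⬝ᵥ x

/-- The pairing of a chart weight `(σ, t)` with a point. [folklore] -/
private theorem vec2_dotProduct (σ t : ℝ) (x : Fin 2 → ℝ) : ![σ, t] ⬝ᵥ x = σ * x 0 + t * x 1 := by
  simp [dotProduct, Fin.sum_univ_two]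

namespace IsStrictTop

variable {w : Fin 2 → ℝ} {F A B : Finset (Fin 2 → ℝ)} {x x' a b s : Fin 2 → ℝ}

/-- A strict top belongs to the set. [cite: Schneider1993, §1.7 (support set F(K,u); Cor 1.7.3: a one-point support set; held text p0043:L7, p0045:L29)] -/
theorem mem (h : IsStrictTop w F x) : x ∈ F := h.1

/-- Every other point has strictly smaller weight. [cite: Schneider1993, §1.7 (support set F(K,u); Cor 1.7.3: a one-point support set; held text p0043:L7, p0045:L29)] -/
theorem lt (h : IsStrictTop w F x) {y : Fin 2 → ℝ} (hy : y ∈ F) (hne : y ≠ x) :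
    w ⬝ᵥ y < w ⬝ᵥ x := h.2 y hy hne

/-- Every point has weight at most that of the strict top. [cite: Schneider1993, §1.7 (support set F(K,u); Cor 1.7.3: a one-point support set; held text p0043:L7, p0045:L29)] -/
theorem le (h : IsStrictTop w F x) {y : Fin 2 → ℝ} (hy : y ∈ F) : w ⬝ᵥ y ≤ w ⬝ᵥ x := by
  by_cases hne : y = x
  · rw [hne]
  · exact (h.2 y hy hne).le

/-- Strict tops are unique (a one-point support set). [cite: Schneider1993, §1.7 (support set F(K,u); Cor 1.7.3: a one-point support set; held text p0043:L7, p0045:L29)] -/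
theorem unique (h : IsStrictTop w F x) (h' : IsStrictTop w F x') : x = x' := by
  by_contra hne
  have h1 := h.2 x' h'.1 (Ne.symm hne)
  have h2 := h'.2 x h.1 hne
  exact lt_asymm h1 h2

/-- Positive rescaling of the weight does not change the support set. [cite: Schneider1993, §1.7 (support set F(K,u); Cor 1.7.3: a one-point support set; held text p0043:L7, p0045:L29)] -/
theorem smul_pos (h : IsStrictTop w F x) {c : ℝ} (hc : 0 < c) : IsStrictTop (c • w) F x := by
  refine ⟨h.1, fun y hy hne => ?_⟩
  rw [smul_dotProduct, smul_dotProduct, smul_eq_mul, smul_eq_mul]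
  exact mul_lt_mul_of_pos_left (h.2 y hy hne) hc

/-- Strict tops add up: the sum of the strict `w`-tops of `A` and `B` is the strict `w`-top of
the Minkowski sum `A + B` (support sets add). [cite: Schneider1993, Thm 1.7.5(c) (support sets add: F(K+L,u) = F(K,u) + F(L,u); held text p0046:L30–L34)] -/
theorem add (ha : IsStrictTop w A a) (hb : IsStrictTop w B b) : IsStrictTop w (A + B) (a + b) := by
  refine ⟨Finset.add_mem_add ha.1 hb.1, fun y hy hne => ?_⟩
  obtain ⟨a', ha', b', hb', rfl⟩ := Finset.mem_add.1 hy
  rw [dotProduct_add, dotProduct_add]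
  by_cases h1 : a' = a
  · subst h1
    have h2 : b' ≠ b := fun h => hne (by rw [h])
    have := hb.2 b' hb' h2
    linarith
  · have := ha.2 a' ha' h1
    have := hb.le hb'
    linarith

/-- Converse: a strict top of `A + B` (both nonempty) is the sum of the strict tops of `A` and
`B`, which exist (support sets add, so a one-point support set of the sum has one-point summands).
[cite: Schneider1993, Thm 1.7.5(c) (support sets add: F(K+L,u) = F(K,u) + F(L,u); held text p0046:L30–L34)] -/
theorem exists_eq_add (hA : A.Nonempty) (hB : B.Nonempty) (hs : IsStrictTop w (A + B) s) :
    ∃ a b, IsStrictTop w A a ∧ IsStrictTop w B b ∧ s = a + b := by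
  obtain ⟨a, ha, hamax⟩ := Finset.exists_max_image A (fun y => w ⬝ᵥ y) hA
  obtain ⟨b, hb, hbmax⟩ := Finset.exists_max_image B (fun y => w ⬝ᵥ y) hB
  have hab : a + b ∈ A + B := Finset.add_mem_add ha hb
  -- `a + b` maximises `w` on `A + B`, hence is the strict top `s`
  have hmax : ∀ y ∈ A + B, w ⬝ᵥ y ≤ w ⬝ᵥ (a + b) := by
    intro y hy
    obtain ⟨a', ha', b', hb', rfl⟩ := Finset.mem_add.1 hy
    rw [dotProduct_add, dotProduct_add]
    exact add_le_add (hamax a' ha') (hbmax b' hb')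
  have hseq : s = a + b := by
    by_contra hne
    have h1 := hs.2 (a + b) hab (Ne.symm hne)
    have h2 := hmax s hs.1
    exact lt_irrefl _ (h1.trans_le h2)
  refine ⟨a, b, ⟨ha, fun a' ha' hne => ?_⟩, ⟨hb, fun b' hb' hne => ?_⟩, hseq⟩
  · refine lt_of_le_of_ne (hamax a' ha') fun heq => ?_
    have hmem : a' + b ∈ A + B := Finset.add_mem_add ha' hb
    have hne' : a' + b ≠ s := by rw [hseq]; exact fun h => hne (add_right_cancel h)
    have h1 := hs.2 _ hmem hne'
    rw [hseq, dotProduct_add, dotProduct_add, heq] at h1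
    exact lt_irrefl _ h1
  · refine lt_of_le_of_ne (hbmax b' hb') fun heq => ?_
    have hmem : a + b' ∈ A + B := Finset.add_mem_add ha hb'
    have hne' : a + b' ≠ s := by rw [hseq]; exact fun h => hne (add_left_cancel h)
    have h1 := hs.2 _ hmem hne'
    rw [hseq, dotProduct_add, dotProduct_add, heq] at h1
    exact lt_irrefl _ h1

/-- A strict top (an exposed point) is a vertex of the convex hull. [cite: Schneider1993, §2.4 (each extreme point of a polytope is an exposed point; held text p0103:L3)] -/
theorem mem_extremePoints (h : IsStrictTop w F x) :
    x ∈ (convexHull ℝ (F : Set (Fin 2 → ℝ))).extremePoints ℝ := by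
  let l : (Fin 2 → ℝ) →ₗ[ℝ] ℝ :=
    { toFun := fun y => w ⬝ᵥ y
      map_add' := fun y z => dotProduct_add w y z
      map_smul' := fun c y => by simp [dotProduct_smul] }
  exact mem_extremePoints_convexHull_of_linear (Finset.mem_coe.2 h.1) l
    fun q hq hne => h.2 q (Finset.mem_coe.1 hq) hne

/-- Interval fibres along an affine chart of weights `t ↦ (σ, t)`: if `x` is the strict top at
`t₁` and at `t₃`, then at every `t₂ ∈ [t₁, t₃]` (the weight is affine in `t`). [cite: KoiranPortierTavenasThomasse2015, §2 (p.4; step of our proof of the vertex bound)] -/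
theorem of_between {σ t₁ t₂ t₃ : ℝ} (h₁ : IsStrictTop ![σ, t₁] F x) (h₃ : IsStrictTop ![σ, t₃] F x)
    (h12 : t₁ ≤ t₂) (h23 : t₂ ≤ t₃) : IsStrictTop ![σ, t₂] F x := by
  refine ⟨h₁.1, fun y hy hne => ?_⟩
  have e1 := h₁.2 y hy hne
  have e3 := h₃.2 y hy hne
  simp only [vec2_dotProduct] at e1 e3 ⊢
  by_cases hd : y 1 ≤ x 1
  · nlinarith
  · nlinarith

/-- A strict top in BOTH half-charts `(1, t)` and `(-1, u)` is the unique top or the unique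
bottom point of `F` (add the two weights: `(0, t + u)`). [folklore] -/
private theorem top_or_bot_of_charts {t u : ℝ} (h₁ : IsStrictTop ![1, t] F x) (h₂ : IsStrictTop ![-1, u] F x) :
    IsStrictTop ![0, 1] F x ∨ IsStrictTop ![0, -1] F x := by
  rcases lt_or_ge 0 (t + u) with hpos | hle
  · refine Or.inl ⟨h₁.1, fun y hy hne => ?_⟩
    have e1 := h₁.2 y hy hne
    have e2 := h₂.2 y hy hne
    simp only [vec2_dotProduct] at e1 e2 ⊢
    nlinarith
  · rcases lt_or_eq_of_le hle with hneg | hzero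
    · refine Or.inr ⟨h₁.1, fun y hy hne => ?_⟩
      have e1 := h₁.2 y hy hne
      have e2 := h₂.2 y hy hne
      simp only [vec2_dotProduct] at e1 e2 ⊢
      nlinarith
    · -- `t + u = 0`: then `F = {x}` and the claim is vacuous
      refine Or.inl ⟨h₁.1, fun y hy hne => ?_⟩
      have e1 := h₁.2 y hy hne
      have e2 := h₂.2 y hy hne
      simp only [vec2_dotProduct] at e1 e2 ⊢
      nlinarith

end IsStrictTop

/-- Vertex decompositions are unique: a vertex of `conv(A + B)` is a sum `a + b`, `a ∈ A`,
`b ∈ B`, in exactly one way. [cite: Schneider1993, §2.4 (each extreme point of P₁ + P₂ is the sum of an extreme point of P₁ and one of P₂; held text p0102:L9)] -/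
theorem eq_of_add_eq_of_mem_extremePoints {A B : Finset (Fin 2 → ℝ)} {s a a' b b' : Fin 2 → ℝ}
    (hs : s ∈ (convexHull ℝ ((A + B : Finset (Fin 2 → ℝ)) : Set (Fin 2 → ℝ))).extremePoints ℝ)
    (ha : a ∈ A) (ha' : a' ∈ A) (hb : b ∈ B) (hb' : b' ∈ B) (h : a + b = s) (h' : a' + b' = s) :
    a = a' ∧ b = b' := by
  have h1 : a + b' ∈ convexHull ℝ ((A + B : Finset (Fin 2 → ℝ)) : Set (Fin 2 → ℝ)) :=
    subset_convexHull ℝ _ (Finset.mem_coe.2 (Finset.add_mem_add ha hb'))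
  have h2 : a' + b ∈ convexHull ℝ ((A + B : Finset (Fin 2 → ℝ)) : Set (Fin 2 → ℝ)) :=
    subset_convexHull ℝ _ (Finset.mem_coe.2 (Finset.add_mem_add ha' hb))
  have hsum : (a + b') + (a' + b) = s + s := by
    rw [show s + s = (a + b) + (a' + b') by rw [h, h']]
    abel
  have key := Literature.Algebra.Polynomial.NewtonPolytope.eq_of_mem_extremePoints_of_add_eq
    (𝕜 := ℝ) hs h1 h2 hsum
  have hbb : b' = b := by
    have := key.1; rw [← h] at this; exact add_left_cancel this
  refine ⟨?_, hbb.symm⟩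
  have := key.2
  rw [← h] at this
  exact (add_right_cancel this).symm

/-! ### The pair count along a chart -/

/-- **Pair count.** Two maps on a finite set of times in a linear order whose fibres are
intervals realise at most `#values(f) + #values(g) - 1` distinct pairs (induction on the largest
time: a new pair has a new component). [folklore] -/
private theorem card_image_pair_add_one_le {α β : Type*} [DecidableEq α] [DecidableEq β]
    (f : ℝ → α) (g : ℝ → β) (T : Finset ℝ) (hT : T.Nonempty)
    (hf : ∀ t₁ ∈ T, ∀ t₂ ∈ T, ∀ t₃ ∈ T, t₁ ≤ t₂ → t₂ ≤ t₃ → f t₁ = f t₃ → f t₂ = f t₃)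
    (hg : ∀ t₁ ∈ T, ∀ t₂ ∈ T, ∀ t₃ ∈ T, t₁ ≤ t₂ → t₂ ≤ t₃ → g t₁ = g t₃ → g t₂ = g t₃) :
    (T.image fun t => (f t, g t)).card + 1 ≤ (T.image f).card + (T.image g).card := by
  classical
  -- induction on the largest time
  induction T using Finset.induction_on_max with
  | empty => exact absurd hT Finset.not_nonempty_empty
  | insert m T hlt ih =>
    by_cases hTe : T = ∅
    · subst hTe
      simp
    have hTne : T.Nonempty := Finset.nonempty_iff_ne_empty.2 hTe
    have hfT : ∀ t₁ ∈ T, ∀ t₂ ∈ T, ∀ t₃ ∈ T, t₁ ≤ t₂ → t₂ ≤ t₃ → f t₁ = f t₃ → f t₂ = f t₃ :=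
      fun t₁ h₁ t₂ h₂ t₃ h₃ => hf t₁ (Finset.mem_insert_of_mem h₁) t₂ (Finset.mem_insert_of_mem h₂)
        t₃ (Finset.mem_insert_of_mem h₃)
    have hgT : ∀ t₁ ∈ T, ∀ t₂ ∈ T, ∀ t₃ ∈ T, t₁ ≤ t₂ → t₂ ≤ t₃ → g t₁ = g t₃ → g t₂ = g t₃ :=
      fun t₁ h₁ t₂ h₂ t₃ h₃ => hg t₁ (Finset.mem_insert_of_mem h₁) t₂ (Finset.mem_insert_of_mem h₂)
        t₃ (Finset.mem_insert_of_mem h₃)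
    have ih' := ih hTne hfT hgT
    rw [Finset.image_insert, Finset.image_insert, Finset.image_insert]
    by_cases hp : (f m, g m) ∈ T.image fun t => (f t, g t)
    · rw [Finset.insert_eq_of_mem hp]
      exact ih'.trans (add_le_add (Finset.card_le_card (Finset.subset_insert _ _))
        (Finset.card_le_card (Finset.subset_insert _ _)))
    · rw [Finset.card_insert_of_notMem hp]
      -- the new pair has a new component
      have hnew : f m ∉ T.image f ∨ g m ∉ T.image g := by
        by_contra hboth
        push Not at hboth
        obtain ⟨hfm, hgm⟩ := hboth
        obtain ⟨i, hi, hfi⟩ := Finset.mem_image.1 hfm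
        obtain ⟨j, hj, hgj⟩ := Finset.mem_image.1 hgm
        have him : i ≤ m := (hlt i hi).le
        have hjm : j ≤ m := (hlt j hj).le
        apply hp
        rcases le_total i j with hij | hji
        · -- fibre of `f` through `i ≤ j ≤ m`
          have hfj : f j = f m :=
            hf i (Finset.mem_insert_of_mem hi) j (Finset.mem_insert_of_mem hj) m
              (Finset.mem_insert_self _ _) hij hjm hfi
          exact Finset.mem_image.2 ⟨j, hj, by rw [hfj, hgj]⟩
        · have hgi : g i = g m :=
            hg j (Finset.mem_insert_of_mem hj) i (Finset.mem_insert_of_mem hi) m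
              (Finset.mem_insert_self _ _) hji him hgj
          exact Finset.mem_image.2 ⟨i, hi, by rw [hfi, hgi]⟩
      rcases hnew with hfn | hgn
      · rw [Finset.card_insert_of_notMem hfn]
        have := Finset.card_le_card (Finset.subset_insert (g m) (T.image g))
        omega
      · rw [Finset.card_insert_of_notMem hgn]
        have := Finset.card_le_card (Finset.subset_insert (f m) (T.image f))
        omega

/-! ### Exposure: every vertex of the hull of a finite planar set is a strict top, and in fact a
strict top along one of the two affine half-charts of weights `(1, t)`, `(-1, t)` -/

namespace IsStrictTop

variable {w : Fin 2 → ℝ} {F : Finset (Fin 2 → ℝ)} {x : Fin 2 → ℝ}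

/-- Strict exposure is an open condition on the weight: perturbing the weight along any fixed
direction `d` by a small amount keeps a strict top (finitely many strict inequalities).
[cite: KoiranPortierTavenasThomasse2015, §2 (p.4; step of our proof of the vertex bound)] -/
theorem exists_perturb_dir (h : IsStrictTop w F x) (d : Fin 2 → ℝ) :
    ∃ ε : ℝ, 0 < ε ∧ ∀ δ : ℝ, |δ| ≤ ε → IsStrictTop (w + δ • d) F x := by
  classical
  by_cases hE : (F.erase x).Nonempty
  · -- gap `γ > 0` of the strict inequalities and bound `M` on `|d ⬝ (x - y)|`
    obtain ⟨y₀, hy₀, hγ⟩ := Finset.exists_max_image (F.erase x) (fun y => w ⬝ᵥ y) hE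
    obtain ⟨y₁, hy₁, hM⟩ := Finset.exists_max_image (F.erase x) (fun y => |d ⬝ᵥ x - d ⬝ᵥ y|) hE
    set γ := w ⬝ᵥ x - w ⬝ᵥ y₀ with hγdef
    set M := |d ⬝ᵥ x - d ⬝ᵥ y₁| with hMdef
    have hγpos : 0 < γ := by
      have := h.2 y₀ (Finset.mem_of_mem_erase hy₀) (Finset.ne_of_mem_erase hy₀)
      rw [hγdef]; linarith
    have hM0 : 0 ≤ M := abs_nonneg _
    refine ⟨γ / (2 * (M + 1)), by positivity, fun δ hδ => ⟨h.1, fun y hy hne => ?_⟩⟩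
    have hyE : y ∈ F.erase x := Finset.mem_erase.2 ⟨hne, hy⟩
    have hgap : w ⬝ᵥ y ≤ w ⬝ᵥ x - γ := by
      have := hγ y hyE
      rw [hγdef]; linarith
    have hMy : |d ⬝ᵥ x - d ⬝ᵥ y| ≤ M := hM y hyE
    rw [add_dotProduct, add_dotProduct, smul_dotProduct, smul_dotProduct, smul_eq_mul, smul_eq_mul]
    have hδM : |δ * (d ⬝ᵥ x - d ⬝ᵥ y)| ≤ γ / (2 * (M + 1)) * M := by
      rw [abs_mul]
      exact mul_le_mul hδ hMy (abs_nonneg _) (by positivity)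
    have hlt : γ / (2 * (M + 1)) * M < γ := by
      rw [div_mul_eq_mul_div, div_lt_iff₀ (by positivity)]
      nlinarith
    have habs := abs_le.1 hδM
    have hexp : δ * (d ⬝ᵥ x - d ⬝ᵥ y) = δ * (d ⬝ᵥ x) - δ * (d ⬝ᵥ y) := by ring
    linarith [habs.1, habs.2]
  · -- `F = {x}`: every weight works
    refine ⟨1, one_pos, fun δ _ => ⟨h.1, fun y hy hne => ?_⟩⟩
    exact absurd ⟨y, Finset.mem_erase.2 ⟨hne, hy⟩⟩ hE

/-- Perturbing the first coordinate of the weight keeps a strict top. [folklore] -/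
private theorem exists_perturb (h : IsStrictTop w F x) :
    ∃ ε : ℝ, 0 < ε ∧ ∀ δ : ℝ, |δ| ≤ ε → IsStrictTop (w + ![δ, 0]) F x := by
  obtain ⟨ε, hε, hp⟩ := h.exists_perturb_dir ![1, 0]
  refine ⟨ε, hε, fun δ hδ => ?_⟩
  have e : w + ![δ, 0] = w + δ • ![1, 0] := by
    ext i; fin_cases i <;> simp
  rw [e]
  exact hp δ hδ

/-- Perturbing the chart parameter keeps a strict top: strict tops along a chart form an open set
of parameters. [cite: KoiranPortierTavenasThomasse2015, §2 (p.4; step of our proof of the vertex bound)] -/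
theorem exists_perturb_chart {σ t₀ : ℝ} (h : IsStrictTop ![σ, t₀] F x) :
    ∃ ε : ℝ, 0 < ε ∧ ∀ t : ℝ, |t - t₀| ≤ ε → IsStrictTop ![σ, t] F x := by
  obtain ⟨ε, hε, hp⟩ := h.exists_perturb_dir ![0, 1]
  refine ⟨ε, hε, fun t ht => ?_⟩
  have e : (![σ, t] : Fin 2 → ℝ) = ![σ, t₀] + (t - t₀) • ![0, 1] := by
    ext i; fin_cases i <;> simp
  rw [e]
  exact hp (t - t₀) ht

/-- A strict top for a weight with POSITIVE first coordinate is a strict top along the chart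
`(1, t)`; with NEGATIVE first coordinate, along `(-1, t)`. [folklore] -/
private theorem exists_chart_of_fst_ne_zero (h : IsStrictTop w F x) (hw : w 0 ≠ 0) :
    ∃ t : ℝ, IsStrictTop ![1, t] F x ∨ IsStrictTop ![-1, t] F x := by
  rcases lt_or_gt_of_ne hw with hneg | hpos
  · refine ⟨w 1 / (-w 0), Or.inr ?_⟩
    have hc : 0 < (-w 0)⁻¹ := inv_pos.2 (neg_pos.2 hneg)
    have key := h.smul_pos hc
    have hw' : (-w 0)⁻¹ • w = ![-1, w 1 / (-w 0)] := by
      ext i; fin_cases i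
      · show (-w 0)⁻¹ * w 0 = -1
        rw [inv_mul_eq_div, div_neg, div_self hw]
      · show (-w 0)⁻¹ * w 1 = w 1 / (-w 0)
        rw [div_eq_inv_mul]
    rwa [hw'] at key
  · refine ⟨w 1 / w 0, Or.inl ?_⟩
    have hc : 0 < (w 0)⁻¹ := inv_pos.2 hpos
    have key := h.smul_pos hc
    have hw' : (w 0)⁻¹ • w = ![1, w 1 / w 0] := by
      ext i; fin_cases i
      · simp [hw]
      · simp [div_eq_inv_mul]
    rwa [hw'] at key

/-- Every strict top is a strict top along one of the two half-charts. [folklore] -/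
private theorem exists_chart (h : IsStrictTop w F x) :
    ∃ t : ℝ, IsStrictTop ![1, t] F x ∨ IsStrictTop ![-1, t] F x := by
  by_cases hw : w 0 ≠ 0
  · exact h.exists_chart_of_fst_ne_zero hw
  · push Not at hw
    obtain ⟨ε, hε, hpert⟩ := h.exists_perturb
    have h' := hpert ε (by rw [abs_of_pos hε])
    refine h'.exists_chart_of_fst_ne_zero ?_
    simp [hw, hε.ne']

/-- The unique top point (strict top for the weight `(0, s)`) is a strict top in BOTH charts.
[folklore] -/
private theorem charts_of_vertical {s : ℝ} (h : IsStrictTop ![0, s] F x) :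
    (∃ t : ℝ, IsStrictTop ![1, t] F x) ∧ ∃ t : ℝ, IsStrictTop ![-1, t] F x := by
  obtain ⟨ε, hε, hpert⟩ := h.exists_perturb
  have hp := hpert ε (by rw [abs_of_pos hε])
  have hm := hpert (-ε) (by rw [abs_neg, abs_of_pos hε])
  have hc : 0 < ε⁻¹ := inv_pos.2 hε
  have hp' := hp.smul_pos hc
  have hm' := hm.smul_pos hc
  have e1 : ε⁻¹ • (![0, s] + ![ε, 0]) = ![1, ε⁻¹ * s] := by
    ext i; fin_cases i
    · simp [hε.ne']
    · simp
  have e2 : ε⁻¹ • (![0, s] + ![-ε, 0]) = ![-1, ε⁻¹ * s] := by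
    ext i; fin_cases i
    · simp [hε.ne']
    · simp
  rw [e1] at hp'
  rw [e2] at hm'
  exact ⟨⟨_, hp'⟩, ⟨_, hm'⟩⟩

end IsStrictTop

/-- **Exposure.** Every vertex of the convex hull of a finite planar set is the strict top for
some weight, i.e. an exposed point (Hahn–Banach against the hull of the other points).
[cite: Schneider1993, §2.4 (each extreme point of a polytope is an exposed point; held text p0103:L3)] -/
theorem exists_isStrictTop_of_mem_extremePoints {F : Finset (Fin 2 → ℝ)} {x : Fin 2 → ℝ}
    (hx : x ∈ (convexHull ℝ (F : Set (Fin 2 → ℝ))).extremePoints ℝ) :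
    ∃ w : Fin 2 → ℝ, IsStrictTop w F x := by
  have hxF : x ∈ (F : Set (Fin 2 → ℝ)) := extremePoints_convexHull_subset hx
  have hnot : x ∉ convexHull ℝ ((F : Set (Fin 2 → ℝ)) \ {x}) := by
    have h := ((convex_convexHull ℝ (F : Set (Fin 2 → ℝ))).mem_extremePoints_iff_mem_sdiff_convexHull_sdiff).1 hx
    have hsub : (F : Set (Fin 2 → ℝ)) \ {x} ⊆ convexHull ℝ (F : Set (Fin 2 → ℝ)) \ {x} :=
      fun y hy => ⟨subset_convexHull ℝ _ hy.1, hy.2⟩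
    exact fun h' => h.2 (convexHull_mono hsub h')
  obtain ⟨f, u, hfu, hf⟩ := geometric_hahn_banach_point_closed (convex_convexHull ℝ _)
    (Set.Finite.isCompact_convexHull (𝕜 := ℝ) (F.finite_toSet.subset fun y hy => hy.1)).isClosed hnot
  have hf2 : ∀ y : Fin 2 → ℝ, f y = (fun i => f (Pi.single i 1)) ⬝ᵥ y := by
    intro y
    have hy : y = y 0 • (Pi.single 0 1 : Fin 2 → ℝ) + y 1 • (Pi.single 1 1 : Fin 2 → ℝ) := by
      ext i
      fin_cases i <;> simp
    conv_lhs => rw [hy]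
    simp only [map_add, map_smul, smul_eq_mul, dotProduct, Fin.sum_univ_two]
    ring
  -- `f` separates `x` BELOW the others; use the weight `-f`
  refine ⟨-fun i => f (Pi.single i 1), Finset.mem_coe.1 hxF, fun y hy hne => ?_⟩
  rw [neg_dotProduct, neg_dotProduct, ← hf2, ← hf2, neg_lt_neg_iff]
  exact hfu.trans (hf y (subset_convexHull ℝ _ ⟨Finset.mem_coe.2 hy, hne⟩))

/-- **Vertex charts.** The vertices of the convex hull of a finite planar set are exactly its
points that are strict tops along one of the two affine half-charts of weights `(1, t)`,
`(-1, t)`, `t ∈ ℝ` (exposed points, with the exposing normal rescaled to first coordinate `±1`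
after a perturbation). [cite: Schneider1993, §2.4 (each extreme point of a polytope is an exposed point; held text p0103:L3)] -/
theorem mem_extremePoints_iff_charts {F : Finset (Fin 2 → ℝ)} {x : Fin 2 → ℝ} :
    x ∈ (convexHull ℝ (F : Set (Fin 2 → ℝ))).extremePoints ℝ ↔
      (∃ t : ℝ, IsStrictTop ![1, t] F x) ∨ ∃ t : ℝ, IsStrictTop ![-1, t] F x := by
  constructor
  · intro hx
    obtain ⟨w, hw⟩ := exists_isStrictTop_of_mem_extremePoints hx
    obtain ⟨t, ht | ht⟩ := hw.exists_chart
    · exact Or.inl ⟨t, ht⟩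
    · exact Or.inr ⟨t, ht⟩
  · rintro (⟨t, ht⟩ | ⟨t, ht⟩)
    · exact ht.mem_extremePoints
    · exact ht.mem_extremePoints

/-! ### Generic chart weights (for exchange arguments on sub-sumsets) -/

/-- A weight that is injective on a nonempty finite set has a strict top there (its support set is
a single point). [cite: Schneider1993, §1.7 (support set F(K,u); Cor 1.7.3: a one-point support set; held text p0043:L7, p0045:L29)] -/
theorem exists_isStrictTop_of_injOn {w : Fin 2 → ℝ} {G : Finset (Fin 2 → ℝ)} (hG : G.Nonempty)
    (hinj : Set.InjOn (fun y => w ⬝ᵥ y) (G : Set (Fin 2 → ℝ))) : ∃ y, IsStrictTop w G y := by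
  obtain ⟨y, hy, hmax⟩ := G.exists_max_image (fun y => w ⬝ᵥ y) hG
  refine ⟨y, hy, fun y' hy' hne => lt_of_le_of_ne (hmax y' hy') fun heq => hne ?_⟩
  exact hinj (Finset.mem_coe.2 hy') (Finset.mem_coe.2 hy) heq

/-- **Generic charts.** A vertex `x` of `conv F` is the strict top of `F` for a chart weight
`(σ, t)`, `σ = ±1`, which is moreover INJECTIVE on each member of any prescribed finite family of
finite planar sets (so that each nonempty member has a strict top for the same weight): the strict
tops of `F` along a chart form an open set of parameters, and injectivity fails only at finitely
many parameters (the generic-normal form of "each extreme point of a polytope is exposed").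
[cite: Schneider1993, §2.4 (each extreme point of a polytope is an exposed point; held text p0103:L3)] -/
theorem exists_chart_injOn {ι : Type*} (I : Finset ι) (G : ι → Finset (Fin 2 → ℝ))
    {F : Finset (Fin 2 → ℝ)} {x : Fin 2 → ℝ}
    (hx : x ∈ (convexHull ℝ (F : Set (Fin 2 → ℝ))).extremePoints ℝ) :
    ∃ σ t : ℝ, (σ = 1 ∨ σ = -1) ∧ IsStrictTop ![σ, t] F x ∧
      ∀ i ∈ I, Set.InjOn (fun y => ![σ, t] ⬝ᵥ y) (G i : Set (Fin 2 → ℝ)) := by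
  classical
  -- a chart exposing `x`
  obtain ⟨σ, t₀, hσ, h₀⟩ : ∃ σ t₀ : ℝ, (σ = 1 ∨ σ = -1) ∧ IsStrictTop ![σ, t₀] F x := by
    rcases mem_extremePoints_iff_charts.1 hx with ⟨t, ht⟩ | ⟨t, ht⟩
    · exact ⟨1, t, Or.inl rfl, ht⟩
    · exact ⟨-1, t, Or.inr rfl, ht⟩
  have hσ0 : σ ≠ 0 := by rcases hσ with rfl | rfl <;> norm_num
  obtain ⟨ε, hε, hpert⟩ := h₀.exists_perturb_chart
  -- the finitely many tie parameters
  let Z : Finset ℝ := I.biUnion fun i => ((G i) ×ˢ (G i)).image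
    fun p => -(σ * (p.1 0 - p.2 0)) / (p.1 1 - p.2 1)
  have hinf : (Set.Ioo (t₀ - ε) (t₀ + ε) \ (Z : Set ℝ)).Infinite :=
    (Set.Ioo_infinite (by linarith)).sdiff Z.finite_toSet
  obtain ⟨t, ⟨ht, htZ⟩⟩ := hinf.nonempty
  refine ⟨σ, t, hσ, hpert t ?_, fun i hi y hy y' hy' heq => ?_⟩
  · rw [abs_le]; constructor <;> linarith [ht.1, ht.2]
  · -- equal weights at `t ∉ Z` force `y = y'`
    simp only [vec2_dotProduct] at heq
    by_contra hne
    by_cases h1 : y 1 = y' 1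
    · have h0 : y 0 = y' 0 := by
        have : σ * (y 0 - y' 0) = 0 := by rw [h1] at heq; linarith
        rcases mul_eq_zero.1 this with h | h
        · exact absurd h hσ0
        · linarith
      exact hne (by ext i; fin_cases i <;> assumption)
    · apply htZ
      rw [Finset.mem_coe]
      refine Finset.mem_biUnion.2 ⟨i, hi, Finset.mem_image.2 ⟨(y, y'), Finset.mem_product.2
        ⟨Finset.mem_coe.1 hy, Finset.mem_coe.1 hy'⟩, ?_⟩⟩
      have h1' : y 1 - y' 1 ≠ 0 := sub_ne_zero.2 h1
      field_simp
      linarith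

/-! ### Existence of chart tops -/

/-- A nonempty finite planar set has a strict top along each half-chart `(σ, t)`, `σ ≠ 0`
(the lexicographic maximum for `(σ x₀, x₁)`, with `t > 0` small). [cite: KoiranPortierTavenasThomasse2015, §2 (p.4; step of our proof of the vertex bound)] -/
theorem exists_isStrictTop_chart {F : Finset (Fin 2 → ℝ)} {σ : ℝ} (hσ : σ ≠ 0) (hF : F.Nonempty) :
    ∃ x t, IsStrictTop ![σ, t] F x := by
  classical
  obtain ⟨x₀, hx₀, hmax₀⟩ := F.exists_max_image (fun y => σ * y 0) hF
  set F₀ := F.filter (fun y => σ * y 0 = σ * x₀ 0) with hF₀def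
  have hF₀ : F₀.Nonempty := ⟨x₀, by simp [hF₀def, hx₀]⟩
  obtain ⟨x, hx, hmax₁⟩ := F₀.exists_max_image (fun y => y 1) hF₀
  have hxF : x ∈ F := (Finset.mem_filter.1 hx).1
  have hx0 : σ * x 0 = σ * x₀ 0 := (Finset.mem_filter.1 hx).2
  obtain ⟨yM, -, hM⟩ := F.exists_max_image (fun y => |x 1 - y 1|) hF
  set M := |x 1 - yM 1| with hMdef
  have hM0 : 0 ≤ M := abs_nonneg _
  -- the gap below the top value of `σ y₀`
  by_cases hlow : (F.filter fun y => σ * y 0 < σ * x 0).Nonempty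
  · obtain ⟨yg, hyg, hg⟩ := (F.filter fun y => σ * y 0 < σ * x 0).exists_max_image
      (fun y => σ * y 0) hlow
    set γ := σ * x 0 - σ * yg 0 with hγdef
    have hγ : 0 < γ := by
      have := (Finset.mem_filter.1 hyg).2
      rw [hγdef]; linarith
    refine ⟨x, γ / (M + 1), hxF, fun y hy hne => ?_⟩
    rw [vec2_dotProduct, vec2_dotProduct]
    by_cases hlt : σ * y 0 < σ * x 0
    · have h1 : σ * y 0 ≤ σ * yg 0 := hg y (Finset.mem_filter.2 ⟨hy, hlt⟩)
      have h2 : |x 1 - y 1| ≤ M := hM y hy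
      have h3 : γ / (M + 1) * |x 1 - y 1| ≤ γ / (M + 1) * M :=
        mul_le_mul_of_nonneg_left h2 (by positivity)
      have h4 : γ / (M + 1) * M < γ := by
        rw [div_mul_eq_mul_div, div_lt_iff₀ (by positivity)]; nlinarith
      have h5 : |γ / (M + 1) * (x 1 - y 1)| ≤ γ / (M + 1) * M := by
        rw [abs_mul, abs_of_pos (by positivity : (0 : ℝ) < γ / (M + 1))]; exact h3
      have h6 := (abs_le.1 h5).1
      have h7 : γ / (M + 1) * (x 1 - y 1) = γ / (M + 1) * x 1 - γ / (M + 1) * y 1 := by ring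
      linarith
    · -- same first coordinate: then `y ∈ F₀`, `y 1 < x 1`
      have hle : σ * y 0 ≤ σ * x 0 := by rw [hx0]; exact hmax₀ y hy
      have heq : σ * y 0 = σ * x 0 := le_antisymm hle (not_lt.1 hlt)
      have hyF₀ : y ∈ F₀ := Finset.mem_filter.2 ⟨hy, by rw [heq, hx0]⟩
      have hy1 : y 1 ≤ x 1 := hmax₁ y hyF₀
      have hy0 : y 0 = x 0 := mul_left_cancel₀ hσ heq
      have hy1' : y 1 ≠ x 1 := by
        intro h1
        apply hne
        ext i; fin_cases i
        · exact hy0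
        · exact h1
      have hlt1 : y 1 < x 1 := lt_of_le_of_ne hy1 hy1'
      have : 0 < γ / (M + 1) := by positivity
      nlinarith
  · -- no point below: every `y` has the top value of `σ y₀`
    refine ⟨x, 1, hxF, fun y hy hne => ?_⟩
    rw [vec2_dotProduct, vec2_dotProduct]
    have hle : σ * y 0 ≤ σ * x 0 := by rw [hx0]; exact hmax₀ y hy
    have heq : σ * y 0 = σ * x 0 := by
      by_contra hneq
      exact hlow ⟨y, Finset.mem_filter.2 ⟨hy, lt_of_le_of_ne hle hneq⟩⟩
    have hyF₀ : y ∈ F₀ := Finset.mem_filter.2 ⟨hy, by rw [heq, hx0]⟩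
    have hy1 : y 1 ≤ x 1 := hmax₁ y hyF₀
    have hy0 : y 0 = x 0 := mul_left_cancel₀ hσ heq
    have hy1' : y 1 ≠ x 1 := by
      intro h1
      apply hne
      ext i; fin_cases i
      · exact hy0
      · exact h1
    have hlt1 : y 1 < x 1 := lt_of_le_of_ne hy1 hy1'
    nlinarith

/-! ### The chart count: tops of `A + B` along one half-chart -/

open Classical in
/-- Along one half-chart of weights `(σ, t)`, the Minkowski sum `A + B` has at most
`#(chart tops of A) + #(chart tops of B) - 1` chart tops. [folklore] -/
private theorem card_chartTops_add_le (σ : ℝ) (hσ : σ ≠ 0) {A B : Finset (Fin 2 → ℝ)} (hA : A.Nonempty)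
    (hB : B.Nonempty) :
    ((A + B).filter fun s => ∃ t, IsStrictTop ![σ, t] (A + B) s).card + 1 ≤
      (A.filter fun a => ∃ t, IsStrictTop ![σ, t] A a).card +
        (B.filter fun b => ∃ t, IsStrictTop ![σ, t] B b).card := by
  classical
  set RS := (A + B).filter fun s => ∃ t, IsStrictTop ![σ, t] (A + B) s with hRS
  -- a time for every chart top of `A + B`
  let τ : (Fin 2 → ℝ) → ℝ := fun s =>
    if h : ∃ t, IsStrictTop ![σ, t] (A + B) s then Classical.choose h else 0
  have hτ : ∀ s ∈ RS, IsStrictTop ![σ, τ s] (A + B) s := by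
    intro s hs
    have h := (Finset.mem_filter.1 hs).2
    simp only [τ, dif_pos h]
    exact Classical.choose_spec h
  -- the tops of `A` and `B` at a time (defaulting to `0`)
  let topA : ℝ → (Fin 2 → ℝ) := fun t =>
    if h : ∃ a, IsStrictTop ![σ, t] A a then Classical.choose h else 0
  let topB : ℝ → (Fin 2 → ℝ) := fun t =>
    if h : ∃ b, IsStrictTop ![σ, t] B b then Classical.choose h else 0
  have htopA : ∀ t a, IsStrictTop ![σ, t] A a → topA t = a := by
    intro t a ha
    have h : ∃ a, IsStrictTop ![σ, t] A a := ⟨a, ha⟩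
    simp only [topA, dif_pos h]
    exact (Classical.choose_spec h).unique ha
  have htopB : ∀ t b, IsStrictTop ![σ, t] B b → topB t = b := by
    intro t b hb
    have h : ∃ b, IsStrictTop ![σ, t] B b := ⟨b, hb⟩
    simp only [topB, dif_pos h]
    exact (Classical.choose_spec h).unique hb
  set T := RS.image τ with hT
  -- at every time of `T` both tops exist and add up to the chart top of `A + B`
  have hT' : ∀ t ∈ T, IsStrictTop ![σ, t] A (topA t) ∧ IsStrictTop ![σ, t] B (topB t) := by
    intro t ht
    obtain ⟨s, hs, rfl⟩ := Finset.mem_image.1 ht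
    obtain ⟨a, b, ha, hb, -⟩ := (hτ s hs).exists_eq_add hA hB
    rw [htopA _ a ha, htopB _ b hb]
    exact ⟨ha, hb⟩
  -- `RS` injects into the pairs realised on `T`
  have hcard : RS.card = (T.image fun t => (topA t, topB t)).card := by
    rw [hT, Finset.image_image]
    refine (Finset.card_image_of_injOn fun s hs s' hs' h => ?_).symm
    simp only [Function.comp_apply, Prod.mk.injEq] at h
    obtain ⟨a, b, ha, hb, hs_eq⟩ := (hτ s hs).exists_eq_add hA hB
    obtain ⟨a', b', ha', hb', hs'_eq⟩ := (hτ s' hs').exists_eq_add hA hB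
    rw [htopA _ a ha, htopA _ a' ha'] at h
    rw [htopB _ b hb, htopB _ b' hb'] at h
    rw [hs_eq, hs'_eq, h.1, h.2]
  have hTne : T.Nonempty := by
    rw [hT, Finset.image_nonempty, hRS]
    obtain ⟨x, t, hx⟩ := exists_isStrictTop_chart (F := A + B) hσ (hA.add hB)
    exact ⟨x, Finset.mem_filter.2 ⟨hx.1, t, hx⟩⟩
  -- interval fibres
  have hfA : ∀ t₁ ∈ T, ∀ t₂ ∈ T, ∀ t₃ ∈ T, t₁ ≤ t₂ → t₂ ≤ t₃ → topA t₁ = topA t₃ →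
      topA t₂ = topA t₃ := by
    intro t₁ h₁ t₂ h₂ t₃ h₃ h12 h23 heq
    have k₁ := (hT' t₁ h₁).1
    rw [heq] at k₁
    exact htopA t₂ _ (k₁.of_between (hT' t₃ h₃).1 h12 h23)
  have hfB : ∀ t₁ ∈ T, ∀ t₂ ∈ T, ∀ t₃ ∈ T, t₁ ≤ t₂ → t₂ ≤ t₃ → topB t₁ = topB t₃ →
      topB t₂ = topB t₃ := by
    intro t₁ h₁ t₂ h₂ t₃ h₃ h12 h23 heq
    have k₁ := (hT' t₁ h₁).2
    rw [heq] at k₁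
    exact htopB t₂ _ (k₁.of_between (hT' t₃ h₃).2 h12 h23)
  have hpair := card_image_pair_add_one_le topA topB T hTne hfA hfB
  have hsubA : T.image topA ⊆ A.filter fun a => ∃ t, IsStrictTop ![σ, t] A a := by
    intro a ha
    obtain ⟨t, ht, rfl⟩ := Finset.mem_image.1 ha
    exact Finset.mem_filter.2 ⟨(hT' t ht).1.1, t, (hT' t ht).1⟩
  have hsubB : T.image topB ⊆ B.filter fun b => ∃ t, IsStrictTop ![σ, t] B b := by
    intro b hb
    obtain ⟨t, ht, rfl⟩ := Finset.mem_image.1 hb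
    exact Finset.mem_filter.2 ⟨(hT' t ht).2.1, t, (hT' t ht).2⟩
  rw [hcard]
  exact hpair.trans (add_le_add (Finset.card_le_card hsubA) (Finset.card_le_card hsubB))

/-! ### The vertex count of a planar Minkowski sum -/

open Classical in
/-- The vertex set of the hull of a finite planar set, as the finite set of its chart tops.
[folklore] -/
private theorem extremePoints_eq_coe_filter (F : Finset (Fin 2 → ℝ)) :
    (convexHull ℝ (F : Set (Fin 2 → ℝ))).extremePoints ℝ =
      ↑(F.filter fun x => (∃ t : ℝ, IsStrictTop ![1, t] F x) ∨ ∃ t : ℝ, IsStrictTop ![-1, t] F x) := by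
  ext x
  rw [Finset.coe_filter, Set.mem_setOf_eq, mem_extremePoints_iff_charts]
  constructor
  · rintro (⟨t, ht⟩ | ⟨t, ht⟩)
    · exact ⟨ht.1, Or.inl ⟨t, ht⟩⟩
    · exact ⟨ht.1, Or.inr ⟨t, ht⟩⟩
  · exact fun h => h.2

/-- A nonempty finite planar set has at least one hull vertex. [cite: Schneider1993, Cor 1.4.5 (Minkowski: a convex body is the convex hull of its extreme points; held text p0026:L19)] -/
theorem one_le_ncard_extremePoints {F : Finset (Fin 2 → ℝ)} (hF : F.Nonempty) :
    1 ≤ ((convexHull ℝ (F : Set (Fin 2 → ℝ))).extremePoints ℝ).ncard := by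
  obtain ⟨x, t, hx⟩ := exists_isStrictTop_chart (F := F) one_ne_zero hF
  have hfin : ((convexHull ℝ (F : Set (Fin 2 → ℝ))).extremePoints ℝ).Finite :=
    F.finite_toSet.subset extremePoints_convexHull_subset
  rw [Nat.one_le_iff_ne_zero, Ne, Set.ncard_eq_zero hfin]
  exact Set.nonempty_iff_ne_empty.1 ⟨x, hx.mem_extremePoints⟩

/-- **The number of vertices of a planar Minkowski sum** (KPTT 2015, §2, p.4: "if `f` has `s`
monomials and `g` has `t` monomials then `Newt(fg)` has at most `s + t` edges", in the sharper
vertex form; planar case of Gritzmann–Sturmfels 1993): for finite nonempty `A, B ⊂ ℝ²`,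
`conv(A + B)` has at most `#vert conv(A) + #vert conv(B)` vertices.
[cite: KoiranPortierTavenasThomasse2015, §2 (p.4; held text p0004:L15–L19)]
[cite: GritzmannSturmfels1993, §2 (f-vectors of Minkowski sums; planar case, cite-only)] -/
theorem ncard_extremePoints_add_le {A B : Finset (Fin 2 → ℝ)} (hA : A.Nonempty) (hB : B.Nonempty) :
    ((convexHull ℝ ((A + B : Finset (Fin 2 → ℝ)) : Set (Fin 2 → ℝ))).extremePoints ℝ).ncard ≤
      ((convexHull ℝ (A : Set (Fin 2 → ℝ))).extremePoints ℝ).ncard +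
        ((convexHull ℝ (B : Set (Fin 2 → ℝ))).extremePoints ℝ).ncard := by
  classical
  -- chart-top sets
  let R : Finset (Fin 2 → ℝ) → Finset (Fin 2 → ℝ) := fun F =>
    F.filter fun x => ∃ t : ℝ, IsStrictTop ![1, t] F x
  let L : Finset (Fin 2 → ℝ) → Finset (Fin 2 → ℝ) := fun F =>
    F.filter fun x => ∃ t : ℝ, IsStrictTop ![-1, t] F x
  -- unique top / bottom points
  let tp : Finset (Fin 2 → ℝ) → Finset (Fin 2 → ℝ) := fun F => F.filter fun x => IsStrictTop ![0, 1] F x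
  let bt : Finset (Fin 2 → ℝ) → Finset (Fin 2 → ℝ) := fun F => F.filter fun x => IsStrictTop ![0, -1] F x
  have hV : ∀ F : Finset (Fin 2 → ℝ),
      ((convexHull ℝ (F : Set (Fin 2 → ℝ))).extremePoints ℝ).ncard = (R F ∪ L F).card := by
    intro F
    rw [extremePoints_eq_coe_filter F, Set.ncard_coe_finset, Finset.filter_or]
  have hRL : ∀ F : Finset (Fin 2 → ℝ), (R F ∪ L F).card + (R F ∩ L F).card = (R F).card + (L F).card :=
    fun F => Finset.card_union_add_card_inter _ _
  -- `R ∩ L ⊆ tp ∪ bt`, each of size `≤ 1`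
  have hI : ∀ F : Finset (Fin 2 → ℝ), (R F ∩ L F).card ≤ (tp F).card + (bt F).card := by
    intro F
    refine (Finset.card_le_card fun x hx => ?_).trans (Finset.card_union_le _ _)
    rw [Finset.mem_inter, Finset.mem_filter, Finset.mem_filter] at hx
    obtain ⟨⟨hxF, t, ht⟩, -, u, hu⟩ := hx
    rw [Finset.mem_union, Finset.mem_filter, Finset.mem_filter]
    rcases ht.top_or_bot_of_charts hu with h | h
    · exact Or.inl ⟨hxF, h⟩
    · exact Or.inr ⟨hxF, h⟩
  have htp1 : ∀ F : Finset (Fin 2 → ℝ), (tp F).card ≤ 1 := by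
    intro F
    refine Finset.card_le_one.2 fun x hx y hy => ?_
    exact (Finset.mem_filter.1 hx).2.unique (Finset.mem_filter.1 hy).2
  have hbt1 : ∀ F : Finset (Fin 2 → ℝ), (bt F).card ≤ 1 := by
    intro F
    refine Finset.card_le_one.2 fun x hx y hy => ?_
    exact (Finset.mem_filter.1 hx).2.unique (Finset.mem_filter.1 hy).2
  -- for the sum `S`: `tp S ∪ bt S ⊆ R S ∩ L S`, and `tp S`, `bt S` disjoint once `2 ≤ #S`
  set S := A + B with hS
  have hSne : S.Nonempty := hA.add hB
  have hsub : tp S ∪ bt S ⊆ R S ∩ L S := by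
    intro x hx
    rw [Finset.mem_inter, Finset.mem_filter, Finset.mem_filter]
    rcases Finset.mem_union.1 hx with hx | hx
    · obtain ⟨hxS, h⟩ := Finset.mem_filter.1 hx
      obtain ⟨h1, h2⟩ := h.charts_of_vertical
      exact ⟨⟨hxS, h1⟩, hxS, h2⟩
    · obtain ⟨hxS, h⟩ := Finset.mem_filter.1 hx
      obtain ⟨h1, h2⟩ := h.charts_of_vertical
      exact ⟨⟨hxS, h1⟩, hxS, h2⟩
  -- tops add up: if `A` and `B` have unique tops then so does `S` (and bottoms)
  have htpS : (tp A).card + (tp B).card ≤ (tp S).card + 1 := by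
    by_cases hA1 : (tp A).Nonempty
    · by_cases hB1 : (tp B).Nonempty
      · obtain ⟨a, ha⟩ := hA1
        obtain ⟨b, hb⟩ := hB1
        have hab : a + b ∈ tp S := by
          have k := (Finset.mem_filter.1 ha).2.add (Finset.mem_filter.1 hb).2
          exact Finset.mem_filter.2 ⟨k.1, k⟩
        have : 1 ≤ (tp S).card := Finset.card_pos.2 ⟨_, hab⟩
        linarith [htp1 A, htp1 B]
      · rw [Finset.not_nonempty_iff_eq_empty.1 hB1, Finset.card_empty]
        linarith [htp1 A]
    · rw [Finset.not_nonempty_iff_eq_empty.1 hA1, Finset.card_empty]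
      linarith [htp1 B]
  have hbtS : (bt A).card + (bt B).card ≤ (bt S).card + 1 := by
    by_cases hA1 : (bt A).Nonempty
    · by_cases hB1 : (bt B).Nonempty
      · obtain ⟨a, ha⟩ := hA1
        obtain ⟨b, hb⟩ := hB1
        have hab : a + b ∈ bt S := by
          have k := (Finset.mem_filter.1 ha).2.add (Finset.mem_filter.1 hb).2
          exact Finset.mem_filter.2 ⟨k.1, k⟩
        have : 1 ≤ (bt S).card := Finset.card_pos.2 ⟨_, hab⟩
        linarith [hbt1 A, hbt1 B]
      · rw [Finset.not_nonempty_iff_eq_empty.1 hB1, Finset.card_empty]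
        linarith [hbt1 A]
    · rw [Finset.not_nonempty_iff_eq_empty.1 hA1, Finset.card_empty]
      linarith [hbt1 B]
  -- chart counts
  have hR : (R S).card + 1 ≤ (R A).card + (R B).card := card_chartTops_add_le 1 one_ne_zero hA hB
  have hL : (L S).card + 1 ≤ (L A).card + (L B).card :=
    card_chartTops_add_le (-1) (neg_ne_zero.2 one_ne_zero) hA hB
  rw [hV S, hV A, hV B]
  by_cases h2 : 2 ≤ S.card
  · -- `tp S` and `bt S` are disjoint
    have hdisj : Disjoint (tp S) (bt S) := by
      rw [Finset.disjoint_left]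
      intro x hx hx'
      have ht := (Finset.mem_filter.1 hx).2
      have hb := (Finset.mem_filter.1 hx').2
      -- a second point of `S` contradicts being both top and bottom
      obtain ⟨y, hy, hne⟩ := Finset.exists_mem_ne h2 x
      have e1 := ht.2 y hy hne
      have e2 := hb.2 y hy hne
      simp only [vec2_dotProduct] at e1 e2
      linarith
    have hIS : (tp S).card + (bt S).card ≤ (R S ∩ L S).card := by
      rw [← Finset.card_union_of_disjoint hdisj]
      exact Finset.card_le_card hsub
    have e1 := hRL S
    have e2 := hRL A
    have e3 := hRL B
    have e4 := hI A
    have e5 := hI B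
    have e6 := htp1 A
    have e7 := htp1 B
    have e8 := hbt1 A
    have e9 := hbt1 B
    omega
  · -- `S` is a singleton: one vertex, and `A` has at least one
    have hS1 : S.card = 1 := by
      have := Finset.card_pos.2 hSne
      omega
    have hle : (R S ∪ L S).card ≤ S.card :=
      Finset.card_le_card (Finset.union_subset (Finset.filter_subset _ _)
        (Finset.filter_subset _ _))
    have hA1 : 1 ≤ (R A ∪ L A).card := by rw [← hV A]; exact one_le_ncard_extremePoints hA
    omega

/-! ### Corollaries: many summands, point-count form, unions -/

/-- The hull of a finite set has at most `#F` vertices ("`Newt(f)` has at most `t` edges if `f`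
has `t` monomials"). [cite: KoiranPortierTavenasThomasse2015, §2 (p.4; held text p0004:L14)] -/
theorem ncard_extremePoints_le_card (F : Finset (Fin 2 → ℝ)) :
    ((convexHull ℝ (F : Set (Fin 2 → ℝ))).extremePoints ℝ).ncard ≤ F.card := by
  rw [← Set.ncard_coe_finset]
  exact Set.ncard_le_ncard extremePoints_convexHull_subset F.finite_toSet

/-- A nonempty sum of nonempty finite sets is nonempty. [folklore] -/
private theorem sum_nonempty {ι : Type*} {s : Finset ι} (hs : s.Nonempty)
    {A : ι → Finset (Fin 2 → ℝ)} (hA : ∀ j ∈ s, (A j).Nonempty) :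
    (∑ j ∈ s, A j : Finset (Fin 2 → ℝ)).Nonempty := by
  induction hs using Finset.Nonempty.cons_induction with
  | singleton b => simpa using hA b (by simp)
  | cons b s hb hs ih =>
    rw [Finset.sum_cons]
    exact (hA b (Finset.mem_cons_self _ _)).add (ih fun j hj => hA j (Finset.mem_cons.2 (Or.inr hj)))

/-- **Many summands** (KPTT 2015, §2: "for a product `f = g_1 ⋯ g_m`, `Newt(f)` has at most
`Σ t_i` edges"): for a nonempty finite family of nonempty finite planar sets,
`#vert conv(Σ_j A_j) ≤ Σ_j #vert conv(A_j)`.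
[cite: KoiranPortierTavenasThomasse2015, §2 (p.4; held text p0004:L20–L22)] -/
theorem ncard_extremePoints_sum_le {ι : Type*} (s : Finset ι) (hs : s.Nonempty)
    (A : ι → Finset (Fin 2 → ℝ)) (hA : ∀ j ∈ s, (A j).Nonempty) :
    ((convexHull ℝ ((∑ j ∈ s, A j : Finset (Fin 2 → ℝ)) : Set (Fin 2 → ℝ))).extremePoints ℝ).ncard ≤
      ∑ j ∈ s, ((convexHull ℝ (A j : Set (Fin 2 → ℝ))).extremePoints ℝ).ncard := by
  -- induction on `s`
  induction hs using Finset.Nonempty.cons_induction with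
  | singleton a => simp
  | cons a s ha hs ih =>
    rw [Finset.sum_cons, Finset.sum_cons]
    have hne : (∑ j ∈ s, A j : Finset (Fin 2 → ℝ)).Nonempty :=
      sum_nonempty hs fun j hj => hA j (Finset.mem_cons.2 (Or.inr hj))
    exact (ncard_extremePoints_add_le (hA a (Finset.mem_cons_self _ _)) hne).trans
      (Nat.add_le_add_left (ih fun j hj => hA j (Finset.mem_cons.2 (Or.inr hj))) _)

/-- Point-count form: `#vert conv(Σ_j A_j) ≤ Σ_j #A_j` ("at most `Σ t_i`").
[cite: KoiranPortierTavenasThomasse2015, §2 (p.4; held text p0004:L20–L22)] -/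
theorem ncard_extremePoints_sum_le_sum_card {ι : Type*} (s : Finset ι)
    (hs : s.Nonempty) (A : ι → Finset (Fin 2 → ℝ)) (hA : ∀ j ∈ s, (A j).Nonempty) :
    ((convexHull ℝ ((∑ j ∈ s, A j : Finset (Fin 2 → ℝ)) : Set (Fin 2 → ℝ))).extremePoints ℝ).ncard ≤
      ∑ j ∈ s, (A j).card :=
  (ncard_extremePoints_sum_le s hs A hA).trans (Finset.sum_le_sum fun j _ =>
    ncard_extremePoints_le_card (A j))

/-- Vertices of the hull of a union are vertices of the hulls of the parts ("`Newt(f)` is the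
convex hull of the union of the Newton polygons of the `k` products").
[cite: KoiranPortierTavenasThomasse2015, §2 (p.4; held text p0004:L69–L73)] -/
theorem extremePoints_convexHull_biUnion_subset {ι : Type*} (s : Finset ι)
    (F : ι → Finset (Fin 2 → ℝ)) [DecidableEq (Fin 2 → ℝ)] :
    (convexHull ℝ ((s.biUnion F : Finset (Fin 2 → ℝ)) : Set (Fin 2 → ℝ))).extremePoints ℝ ⊆
      ⋃ i ∈ s, (convexHull ℝ (F i : Set (Fin 2 → ℝ))).extremePoints ℝ := by
  intro x hx
  have hxU : x ∈ (s.biUnion F : Set (Fin 2 → ℝ)) := extremePoints_convexHull_subset hx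
  rw [Finset.coe_biUnion] at hxU
  obtain ⟨i, hi, hxi⟩ := Set.mem_iUnion₂.1 hxU
  refine Set.mem_iUnion₂.2 ⟨i, hi, ?_⟩
  have hsub : convexHull ℝ (F i : Set (Fin 2 → ℝ)) ⊆
      convexHull ℝ ((s.biUnion F : Finset (Fin 2 → ℝ)) : Set (Fin 2 → ℝ)) :=
    convexHull_mono (Finset.coe_subset.2 (Finset.subset_biUnion_of_mem F hi))
  exact inter_extremePoints_subset_extremePoints_of_subset hsub ⟨subset_convexHull ℝ _ hxi, hx⟩

/-- `#vert conv(⋃_i F_i) ≤ Σ_i #vert conv(F_i)`.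
[cite: KoiranPortierTavenasThomasse2015, §2 (p.4; held text p0004:L69–L73)] -/
theorem ncard_extremePoints_biUnion_le {ι : Type*} (s : Finset ι) (F : ι → Finset (Fin 2 → ℝ))
    [DecidableEq (Fin 2 → ℝ)] :
    ((convexHull ℝ ((s.biUnion F : Finset (Fin 2 → ℝ)) : Set (Fin 2 → ℝ))).extremePoints ℝ).ncard ≤
      ∑ i ∈ s, ((convexHull ℝ (F i : Set (Fin 2 → ℝ))).extremePoints ℝ).ncard := by
  classical
  refine (Set.ncard_le_ncard (extremePoints_convexHull_biUnion_subset s F) ?_).trans ?_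
  · exact Set.Finite.biUnion s.finite_toSet fun i _ =>
      (F i).finite_toSet.subset extremePoints_convexHull_subset
  · -- `ncard` of a finite union over `s`
    induction s using Finset.cons_induction with
    | empty => simp
    | cons a s ha ih =>
      rw [Finset.sum_cons]
      have : (⋃ i ∈ Finset.cons a s ha, (convexHull ℝ (F i : Set (Fin 2 → ℝ))).extremePoints ℝ) =
          (convexHull ℝ (F a : Set (Fin 2 → ℝ))).extremePoints ℝ ∪
            ⋃ i ∈ s, (convexHull ℝ (F i : Set (Fin 2 → ℝ))).extremePoints ℝ := by
        ext x; simp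
      rw [this]
      exact (Set.ncard_union_le _ _).trans (Nat.add_le_add_left ih _)

/-! ### Many summands: tops add -/

namespace IsStrictTop

/-- Strict tops add up over finitely many summands: if `a j` is the strict `w`-top of `A j` for
every `j ∈ s`, then `Σ_{j∈s} a j` is the strict `w`-top of the Minkowski sum `Σ_{j∈s} A j`.
[cite: Schneider1993, Thm 1.7.5(c) (support sets add; held text p0046:L30–L34)] -/
theorem finset_sum {ι : Type*} {w : Fin 2 → ℝ} (s : Finset ι) {A : ι → Finset (Fin 2 → ℝ)}
    {a : ι → (Fin 2 → ℝ)} (h : ∀ j ∈ s, IsStrictTop w (A j) (a j)) :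
    IsStrictTop w (∑ j ∈ s, A j) (∑ j ∈ s, a j) := by
  classical
  induction s using Finset.cons_induction with
  | empty =>
    refine ⟨by simp, fun y hy hne => ?_⟩
    simp only [Finset.sum_empty, Finset.mem_zero] at hy
    exact absurd hy (by simpa using hne)
  | cons b s hb ih =>
    rw [Finset.sum_cons, Finset.sum_cons]
    exact (h b (Finset.mem_cons_self _ _)).add (ih fun j hj => h j (Finset.mem_cons.2 (Or.inr hj)))

/-- Fintype form of `finset_sum`. [cite: Schneider1993, Thm 1.7.5(c) (support sets add; held text p0046:L30–L34)] -/
theorem fintype_sum {ι : Type*} [Fintype ι] {w : Fin 2 → ℝ} {A : ι → Finset (Fin 2 → ℝ)}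
    {a : ι → (Fin 2 → ℝ)} (h : ∀ j, IsStrictTop w (A j) (a j)) :
    IsStrictTop w (∑ j, A j) (∑ j, a j) :=
  finset_sum Finset.univ fun j _ => h j

end IsStrictTop

end PlanarMinkowski

/-! ### Lattice form: sumsets of exponent sets in `ℕ²` (the support item `SumsetVertexBound`) -/

namespace PlanarMinkowski

/-- The real embedding of exponent vectors is additive. [folklore] -/
private theorem natEmb_add (e e' : Fin 2 →₀ ℕ) :
    (fun i : Fin 2 => (((e + e') i : ℕ) : ℝ)) =
      (fun i : Fin 2 => ((e i : ℕ) : ℝ)) + fun i : Fin 2 => ((e' i : ℕ) : ℝ) := by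
  ext i; simp

/-- The real embedding of exponent vectors is injective. [folklore] -/
private theorem natEmb_injective :
    Function.Injective fun e : Fin 2 →₀ ℕ => fun i : Fin 2 => ((e i : ℕ) : ℝ) := by
  intro e e' h
  ext i
  have hi := congr_fun h i
  simp only [Nat.cast_inj] at hi
  exact hi

/-- The image of the sumset `{Σ_j a_j : a_j ∈ A_j}` of exponent sets is the Minkowski sum of the
images ("`Newt(fg) = Newt(f) + Newt(g) = {p + q}`" on supports).
[cite: KoiranPortierTavenasThomasse2015, §2 (p.4; held text p0004:L15–L16)] -/
theorem image_natEmb_sumset {m : ℕ} (A : Fin m → Finset (Fin 2 →₀ ℕ)) :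
    (((Fintype.piFinset A).image fun a => ∑ j, a j).image
        fun e : Fin 2 →₀ ℕ => fun i : Fin 2 => ((e i : ℕ) : ℝ)) =
      ∑ j, (A j).image fun e : Fin 2 →₀ ℕ => fun i : Fin 2 => ((e i : ℕ) : ℝ) := by
  ext x
  simp only [Finset.mem_image, Fintype.mem_piFinset]
  rw [← Finset.mem_coe, Finset.coe_sum, Set.mem_fintype_sum]
  simp only [Finset.coe_image, Set.mem_image, Finset.mem_coe]
  constructor
  · rintro ⟨e, ⟨a, ha, rfl⟩, rfl⟩
    refine ⟨fun j => fun i => ((a j i : ℕ) : ℝ), fun j => ⟨a j, ha j, rfl⟩, ?_⟩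
    ext i; simp
  · rintro ⟨g, hg, rfl⟩
    choose a ha hga using hg
    refine ⟨∑ j, a j, ⟨a, ha, rfl⟩, ?_⟩
    ext i
    simp only [Finset.sum_apply, Finsupp.coe_finsetSum, Nat.cast_sum]
    exact Finset.sum_congr rfl fun j _ => by rw [← hga j]

/-- **`SumsetVertexBound`, exact form.** For `m ≥ 1` nonempty exponent sets `A_j ⊂ ℕ²`, the hull
of the sumset `{Σ_j a_j}` has at most `Σ_j #A_j` vertices. [cite: KoiranPortierTavenasThomasse2015, §2 (p.4)] -/
theorem ncard_extremePoints_sumset_le_sum_card {m : ℕ} (hm : m ≠ 0) (A : Fin m → Finset (Fin 2 →₀ ℕ))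
    (hA : ∀ j, (A j).Nonempty) :
    (Set.extremePoints ℝ (convexHull ℝ ((fun e : Fin 2 →₀ ℕ => fun i : Fin 2 => ((e i : ℕ) : ℝ)) ''
      ((((Fintype.piFinset A).image fun a => ∑ j, a j) : Finset (Fin 2 →₀ ℕ)) :
        Set (Fin 2 →₀ ℕ))))).ncard ≤ ∑ j, (A j).card := by
  classical
  rw [← Finset.coe_image, image_natEmb_sumset]
  have hne : (Finset.univ : Finset (Fin m)).Nonempty :=
    Finset.univ_nonempty_iff.2 ⟨⟨0, Nat.pos_of_ne_zero hm⟩⟩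
  refine (ncard_extremePoints_sum_le_sum_card Finset.univ hne _ fun j _ => (hA j).image _).trans ?_
  exact Finset.sum_le_sum fun j _ => Finset.card_image_le

/-- **`SumsetVertexBound`** (the support item of routes NewtonFrames / DissociatedFixedK, exponent
`c = 2`): for `t`-sets `A_0, …, A_{m-1} ⊂ ℕ²` the hull of the sumset has at most `(m + t + 2)²`
vertices (indeed `≤ m t` when `m ≥ 1` and no `A_j` is empty, `≤ 1` otherwise).
[cite: KoiranPortierTavenasThomasse2015, §2 (p.4)] -/
theorem ncard_extremePoints_sumset_le_sq (m t : ℕ) (A : Fin m → Finset (Fin 2 →₀ ℕ))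
    (hA : ∀ j, (A j).card ≤ t) :
    (Set.extremePoints ℝ (convexHull ℝ ((fun e : Fin 2 →₀ ℕ => fun i : Fin 2 => ((e i : ℕ) : ℝ)) ''
      ((((Fintype.piFinset A).image fun a => ∑ j, a j) : Finset (Fin 2 →₀ ℕ)) :
        Set (Fin 2 →₀ ℕ))))).ncard ≤ (m + t + 2) ^ 2 := by
  classical
  by_cases hm : m = 0
  · -- the sumset is `{0}`
    subst hm
    refine (Set.ncard_le_ncard extremePoints_convexHull_subset (Set.toFinite _)).trans ?_
    rw [Set.ncard_image_of_injective _ natEmb_injective, Set.ncard_coe_finset]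
    refine Finset.card_image_le.trans ?_
    have h1 : (Fintype.piFinset A).card ≤ 1 :=
      Finset.card_le_one.2 fun a _ b _ => funext fun j => j.elim0
    have h2 : 1 ≤ (0 + t + 2) ^ 2 := Nat.one_le_pow _ _ (by omega)
    exact h1.trans h2
  by_cases he : ∃ j, A j = ∅
  · obtain ⟨j, hj⟩ := he
    have : Fintype.piFinset A = ∅ := Fintype.piFinset_eq_empty.2 ⟨j, hj⟩
    rw [this, Finset.image_empty, Finset.coe_empty, Set.image_empty, convexHull_empty,
      extremePoints_empty, Set.ncard_empty]
    exact Nat.zero_le _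
  · have hA' : ∀ j, (A j).Nonempty := fun j => Finset.nonempty_iff_ne_empty.2 fun h => he ⟨j, h⟩
    refine (ncard_extremePoints_sumset_le_sum_card hm A hA').trans ?_
    calc ∑ j, (A j).card ≤ ∑ _j : Fin m, t := Finset.sum_le_sum fun j _ => hA j
      _ = m * t := by simp
      _ ≤ (m + t + 2) ^ 2 := by nlinarith

end PlanarMinkowski

end KPTT

/-! ### Newton polygons of products (KPTT 2015, §2) -/

section NewtonPolygon

open KPTT.PlanarMinkowski MvPolynomial

variable {k : Type*} [CommSemiring k]

/-- A Newton polygon has at most `#supp` vertices ("`Newt(f)` has at most `t` edges if `f` has `t`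
monomials"). [cite: KoiranPortierTavenasThomasse2015, §2 (p.4)] -/
theorem newtonVertexCount_le_card_support (f : MvPolynomial (Fin 2) k) :
    newtonVertexCount f ≤ f.support.card := by
  classical
  unfold newtonVertexCount
  rw [← Finset.coe_image]
  exact (ncard_extremePoints_le_card _).trans Finset.card_image_le

/-- The Newton polygon of `0` has no vertices (no monomials).
[cite: KoiranPortierTavenasThomasse2015, §2 (p.4; held text p0004:L14)] -/
theorem newtonVertexCount_zero : newtonVertexCount (0 : MvPolynomial (Fin 2) k) = 0 :=
  Nat.le_zero.1 ((newtonVertexCount_le_card_support (0 : MvPolynomial (Fin 2) k)).trans (by simp))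

/-- **Ostrowski: vertices of `Newt(p) + Newt(q)` are monomials of `pq`** (no zero divisors): every
vertex of the hull of `supp p + supp q` is the embedding of an exponent of `p * q` — the extreme
monomials do not cancel. [cite: KoiranPortierTavenasThomasse2015, §2 (p.4, "Newt(fg) = Newt(f) + Newt(g)" [Ostro75])] -/
theorem extremePoints_support_add_subset_support_mul [NoZeroDivisors k] (p q : MvPolynomial (Fin 2) k) :
    (convexHull ℝ (((p.support.image fun e : Fin 2 →₀ ℕ => fun i : Fin 2 => ((e i : ℕ) : ℝ)) +
        (q.support.image fun e : Fin 2 →₀ ℕ => fun i : Fin 2 => ((e i : ℕ) : ℝ)) :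
          Finset (Fin 2 → ℝ)) : Set (Fin 2 → ℝ))).extremePoints ℝ ⊆
      (fun e : Fin 2 →₀ ℕ => fun i : Fin 2 => ((e i : ℕ) : ℝ)) '' ((p * q).support : Set (Fin 2 →₀ ℕ)) := by
  classical
  intro s hs
  set emb : (Fin 2 →₀ ℕ) → (Fin 2 → ℝ) := fun e i => ((e i : ℕ) : ℝ) with hemb
  have hsAB : s ∈ ((p.support.image emb + q.support.image emb : Finset (Fin 2 → ℝ)) : Set (Fin 2 → ℝ)) :=
    extremePoints_convexHull_subset hs
  obtain ⟨a, ha, b, hb, hab⟩ := Finset.mem_add.1 (Finset.mem_coe.1 hsAB)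
  obtain ⟨α, hα, rfl⟩ := Finset.mem_image.1 ha
  obtain ⟨β, hβ, rfl⟩ := Finset.mem_image.1 hb
  refine ⟨α + β, ?_, by rw [← hab]; exact natEmb_add α β⟩
  rw [Finset.mem_coe, MvPolynomial.mem_support_iff, MvPolynomial.coeff_mul]
  rw [Finset.sum_eq_single (α, β)]
  · exact mul_ne_zero (MvPolynomial.mem_support_iff.1 hα) (MvPolynomial.mem_support_iff.1 hβ)
  · rintro ⟨α', β'⟩ hmem hne
    rw [Finset.HasAntidiagonal.mem_antidiagonal] at hmem
    by_contra hprod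
    rcases ne_or_eq (coeff α' p) 0 with hα' | hα'
    · rcases ne_or_eq (coeff β' q) 0 with hβ' | hβ'
      · -- a second decomposition of the vertex `s`
        have hα'm : emb α' ∈ p.support.image emb :=
          Finset.mem_image.2 ⟨α', MvPolynomial.mem_support_iff.2 hα', rfl⟩
        have hβ'm : emb β' ∈ q.support.image emb :=
          Finset.mem_image.2 ⟨β', MvPolynomial.mem_support_iff.2 hβ', rfl⟩
        have hsum : emb α' + emb β' = s := by
          rw [← hab, ← natEmb_add α β, ← natEmb_add α' β', hmem]
        have key := eq_of_add_eq_of_mem_extremePoints hs ha hα'm hb hβ'm hab hsum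
        have h1 : α = α' := natEmb_injective key.1
        have h2 : β = β' := natEmb_injective key.2
        exact hne (by rw [h1, h2])
      · exact hprod (by rw [hβ', mul_zero])
    · exact hprod (by rw [hα', zero_mul])
  · intro h
    exact absurd (by simp) h

/-- **`Newt(pq)` has at most `#vert Newt(p) + #vert Newt(q)` vertices** (KPTT 2015, §2: "if `f`
has `s` monomials and `g` has `t` monomials then `Newt(fg)` has at most `s + t` edges", via
`Newt(fg) = Newt(f) + Newt(g)` [Ostro75] and the planar Minkowski-sum vertex bound), over any
commutative semiring without zero divisors. [cite: KoiranPortierTavenasThomasse2015, §2 (p.4)] -/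
theorem newtonVertexCount_mul_le [NoZeroDivisors k] (p q : MvPolynomial (Fin 2) k) :
    newtonVertexCount (p * q) ≤ newtonVertexCount p + newtonVertexCount q := by
  classical
  by_cases hp : p = 0
  · rw [hp, zero_mul, newtonVertexCount_zero]; exact Nat.zero_le _
  by_cases hq : q = 0
  · rw [hq, mul_zero, newtonVertexCount_zero]; exact Nat.zero_le _
  set emb : (Fin 2 →₀ ℕ) → (Fin 2 → ℝ) := fun e i => ((e i : ℕ) : ℝ) with hemb
  set A := p.support.image emb with hAdef
  set B := q.support.image emb with hBdef
  have hA : A.Nonempty := (MvPolynomial.support_nonempty.2 hp).image _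
  have hB : B.Nonempty := (MvPolynomial.support_nonempty.2 hq).image _
  -- `conv(supp pq) = conv(A + B)`
  have hF : emb '' ((p * q).support : Set (Fin 2 →₀ ℕ)) ⊆ ((A + B : Finset (Fin 2 → ℝ)) : Set (Fin 2 → ℝ)) := by
    rintro _ ⟨e, he, rfl⟩
    have he' := MvPolynomial.support_mul p q (Finset.mem_coe.1 he)
    obtain ⟨α, hα, β, hβ, rfl⟩ := Finset.mem_add.1 he'
    rw [Finset.mem_coe]
    have e1 : emb (α + β) = emb α + emb β := natEmb_add α β
    rw [e1]
    exact Finset.add_mem_add (Finset.mem_image_of_mem _ hα) (Finset.mem_image_of_mem _ hβ)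
  have hE := extremePoints_support_add_subset_support_mul p q
  have hconv : convexHull ℝ (emb '' ((p * q).support : Set (Fin 2 →₀ ℕ))) =
      convexHull ℝ ((A + B : Finset (Fin 2 → ℝ)) : Set (Fin 2 → ℝ)) := by
    refine (convexHull_mono hF).antisymm ?_
    rw [← Literature.Analysis.Convex.convexHull_extremePoints_convexHull (𝕜 := ℝ)
      ((A + B).finite_toSet)]
    exact convexHull_mono hE
  have h := ncard_extremePoints_add_le hA hB
  unfold newtonVertexCount
  rw [hconv, hAdef, hBdef, Finset.coe_image, Finset.coe_image] at *
  exact h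

/-- **Products** (KPTT 2015, §2: "for a product `f = g_1 g_2 ⋯ g_m`, `Newt(f)` has at most
`Σ_i t_i` edges where `t_i` is the number of monomials of `g_i`" — in the sharper vertex form).
[cite: KoiranPortierTavenasThomasse2015, §2 (p.4)] -/
theorem newtonVertexCount_prod_le [NoZeroDivisors k] {ι : Type*} [DecidableEq ι] (s : Finset ι)
    (hs : s.Nonempty) (g : ι → MvPolynomial (Fin 2) k) :
    newtonVertexCount (∏ j ∈ s, g j) ≤ ∑ j ∈ s, newtonVertexCount (g j) := by
  induction hs using Finset.Nonempty.cons_induction with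
  | singleton a => simp
  | cons a s ha hs ih =>
    rw [Finset.prod_cons, Finset.sum_cons]
    exact (newtonVertexCount_mul_le _ _).trans (Nat.add_le_add_left ih _)

/-- KPTT's monomial-count form: `#vert Newt(Π_j g_j) ≤ Σ_j t_j`. [cite: KoiranPortierTavenasThomasse2015, §2 (p.4)] -/
theorem newtonVertexCount_prod_le_sum_card [NoZeroDivisors k] {ι : Type*} [DecidableEq ι]
    (s : Finset ι) (hs : s.Nonempty) (g : ι → MvPolynomial (Fin 2) k) :
    newtonVertexCount (∏ j ∈ s, g j) ≤ ∑ j ∈ s, (g j).support.card :=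
  (newtonVertexCount_prod_le s hs g).trans (Finset.sum_le_sum fun j _ =>
    newtonVertexCount_le_card_support (g j))

/-- Uniform form: `m ≥ 1` factors with at most `t` monomials each ⇒ `#vert Newt(Π_j g_j) ≤ m t`.
[cite: KoiranPortierTavenasThomasse2015, §2 (p.4: "each of these k Newton polygons has at most mt vertices")] -/
theorem newtonVertexCount_prod_le_mul [NoZeroDivisors k] {m t : ℕ} (hm : m ≠ 0)
    (g : Fin m → MvPolynomial (Fin 2) k) (hg : ∀ j, (g j).support.card ≤ t) :
    newtonVertexCount (∏ j, g j) ≤ m * t := by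
  classical
  have hne : (Finset.univ : Finset (Fin m)).Nonempty :=
    Finset.univ_nonempty_iff.2 ⟨⟨0, Nat.pos_of_ne_zero hm⟩⟩
  refine (newtonVertexCount_prod_le_sum_card Finset.univ hne g).trans ?_
  calc ∑ j, (g j).support.card ≤ ∑ _j : Fin m, t := Finset.sum_le_sum fun j _ => hg j
    _ = m * t := by simp

/-- **Sums without cancellations** (KPTT 2015, §2: "If there are no cancellations … `Newt(f)` is the
convex hull of the union of the Newton polygons of the `k` products. Each of these `k` Newton
polygons has at most `mt` vertices, so `Newt(f)` has at most `kmt` vertices"): if the support of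
`Σ_i P_i` is the union of the supports, then `#vert Newt(Σ_i P_i) ≤ Σ_i #vert Newt(P_i)`.
[cite: KoiranPortierTavenasThomasse2015, §2 (p.4)] -/
theorem newtonVertexCount_sum_le_of_support_eq {ι : Type*} (s : Finset ι)
    (P : ι → MvPolynomial (Fin 2) k)
    (hnc : (∑ i ∈ s, P i).support = s.biUnion fun i => (P i).support) :
    newtonVertexCount (∑ i ∈ s, P i) ≤ ∑ i ∈ s, newtonVertexCount (P i) := by
  classical
  unfold newtonVertexCount
  rw [hnc, ← Finset.coe_image, Finset.biUnion_image]
  refine (ncard_extremePoints_biUnion_le s _).trans (le_of_eq ?_)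
  refine Finset.sum_congr rfl fun i _ => ?_
  rw [Finset.coe_image]

/-- KPTT's `kmt`: a sum of `k` products of `m ≥ 1` `t`-sparse polynomials WITHOUT cancellations
has a Newton polygon with at most `k m t` vertices. [cite: KoiranPortierTavenasThomasse2015, §2 (p.4)] -/
theorem newtonVertexCount_sum_prod_le_of_support_eq [NoZeroDivisors k] {n m t : ℕ} (hm : m ≠ 0)
    (f : Fin n → Fin m → MvPolynomial (Fin 2) k) (hf : ∀ i j, (f i j).support.card ≤ t)
    (hnc : (∑ i, ∏ j, f i j).support = Finset.univ.biUnion fun i => (∏ j, f i j).support) :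
    newtonVertexCount (∑ i, ∏ j, f i j) ≤ n * m * t := by
  refine (newtonVertexCount_sum_le_of_support_eq Finset.univ _ hnc).trans ?_
  calc ∑ i, newtonVertexCount (∏ j, f i j) ≤ ∑ _i : Fin n, m * t :=
        Finset.sum_le_sum fun i _ => newtonVertexCount_prod_le_mul hm (f i) (hf i)
    _ = n * m * t := by simp [mul_assoc]

end NewtonPolygon


end Literature.Computability.AlgebraicComplexity

end
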